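import Literature.NumberTheory.Automorphic.ScholzeTorsionGalois
import Literature.NumberTheory.GaloisRepresentations.HeckeDeterminant
import Literature.NumberTheory.GaloisRepresentations.GaloisRepFrobeniusProofs
import Literature.RepresentationTheory.Semisimple.CliffordRestriction
import Literature.RepresentationTheory.Semisimple.BrauerNesbitt
import HarnessLib

/-!
# Galois representations attached to mod `p` Hecke eigensystems (Scholze) — consumer forms

Topic `NumberTheory/Automorphic`, namespace `Literature.NumberTheory.Automorphic`.

Proved corollaries of the named fact `Scholze2015_galoisRep_of_modPEigensystem`
(`Literature.NumberTheory.Automorphic.ScholzeTorsionGalois`; [Scholze2015, Cor. V.4.3]), which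
states Scholze's conclusion literally, `det(1 − X·ρ(Frob_v^{geom})) = P_v(X)`
(`Matrix.charpolyRev` of `ρ σ⁻¹` for arithmetic Frobenii `σ`).  The tree's Galois-representation
API (`FramedGaloisRep.HasFrobCharpolyAt`) records `det(X − ρ(Frob_v^{arith}))`; the conversion is
the in-tree `hasFrobCharpolyAt_of_charpolyRev_eq_scholzeHeckePolynomial`, packaged here once for
all consumers taking the fact as a hypothesis `(h : Scholze2015_galoisRep_of_modPEigensystem)`
(D-0014).  The fact itself is not discharged here: its printed proof is Thm. V.4.1 (perfectoid
Siegel modular varieties, the Hodge–Tate period map, Arthur's endoscopic transfer and the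
characteristic-`0` Galois representations of [Scholze2015, Thm. V.1.4]) followed by Chenevier's
reconstruction of a semisimple representation from a determinant over an algebraically closed
field [Scholze2015, proof of Cor. V.4.3, p. 67], none of which is available in Mathlib or
`Literature`.

Since the fact was vendored, Chenevier determinants entered the tree
(`Literature.NumberTheory.GaloisRepresentations.HeckeDeterminant`: `ChenevierDeterminant`,
`GaloisDeterminant.HasGeomFrobRevCharpolyAt` = the printed shape `D(1 − X·Frob_v) = P_v` with
`Frob_v` geometric, and the route-requested notion `HasHeckeDeterminant`).  The second group of
corollaries below is the dictionary: the two encodings of `P_v` agree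
(`scholzeHeckePolynomial_eq_galoisRepresentations`), the representation `σ_ψ` of Cor. V.4.3 gives
the continuous determinant `det ∘ σ_ψ`, unramified outside `S`, with `D(1 − X·Frob_v) = ψ(P_v)`
literally as printed (`Scholze2015_galoisRep_of_modPEigensystem.exists_determinant`), i.e. the
`m = 1`, `ξ = 1` case of [Scholze2015, Thm. V.4.1] specialised along `ψ`, and hence a
`HasHeckeDeterminant F n N S k (ψ(P_·))` for every `N ≥ 1`
(`Scholze2015_galoisRep_of_modPEigensystem.hasHeckeDeterminant`).

## References

* P. Scholze, *On torsion in the cohomology of locally symmetric varieties*, Ann. of Math. (2) 182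
  (2015), 945–1066; arXiv:1306.2070: §V.4, Thm. V.4.1, Cor. V.4.3 (p. 67); p. 55 (geometric
  Frobenius convention). [Scholze2015]
-/

noncomputable section

open scoped NumberField Polynomial
open IsDedekindDomain NumberField Field Polynomial

namespace Literature.NumberTheory.Automorphic

/-! ### Cor. V.4.3 in the tree's (arithmetic-Frobenius) convention -/

/-- **Scholze 2015, Cor. V.4.3 (trivial weight), restated with `det(X − ρ(Frob^{arith}))`.**
A consumer form of the named fact `Scholze2015_galoisRep_of_modPEigensystem`: under its
hypotheses, the representation `ρ` it provides is semisimple, unramified outside `S`, and at every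
`v ∉ S` has Frobenius characteristic polynomial (tree convention
`FramedGaloisRep.HasFrobCharpolyAt`: `det(X − ρ(σ))` for every arithmetic Frobenius `σ` at every
`𝔓 ∣ v`) equal to `scholzeArithFrobPolynomial n q_v (a v) = (−1)ⁿ (q_v^{n(n+1)/2} a_{v,n})⁻¹ · P_v(X)`,
with `det ρ(σ) = (q_v^{n(n+1)/2} a_{v,n})⁻¹`; obtained from Scholze's
`det(1 − X·ρ(Frob_v^{geom})) = P_v(X)` [Scholze2015, Cor. V.4.3, p. 55 (geometric Frobenius)] by
`hasFrobCharpolyAt_of_charpolyRev_eq_scholzeHeckePolynomial`.  Takes the named fact as the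
hypothesis `h` (D-0014). [cite: Scholze2015, Cor. V.4.3 (with Thm. V.4.1, §V.4 pp. 66–67)] -/
theorem Scholze2015_galoisRep_of_modPEigensystem.hasFrobCharpolyAt
    (h : Scholze2015_galoisRep_of_modPEigensystem)
    (F : Type) [Field F] [NumberField F] (hF : IsTotallyReal F ∨ IsCMField F)
    {n : ℕ} (hn : 1 ≤ n) (p : ℕ) [Fact p.Prime] (S : Finset (HeightOneSpectrum (𝓞 F)))
    (hSp : ∀ v : HeightOneSpectrum (𝓞 F), ((p : ℕ) : 𝓞 F) ∈ v.asIdeal → v ∈ S)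
    (hSc : ∀ τ : F ≃ₐ[maximalRealSubfield F] F, ∀ v ∈ S, τ • v ∈ S)
    (hSr : ∀ v : HeightOneSpectrum (𝓞 F), v ∉ S →
      v.asIdeal.ramificationIdx (𝓞 (maximalRealSubfield F)) = 1)
    (K : Subgroup (GL (Fin n) (FiniteAdeleRing (𝓞 F) F)))
    (hKo : IsOpen (K : Set (GL (Fin n) (FiniteAdeleRing (𝓞 F) F))))
    (hKi : K ≤ glFiniteIntegralLevel n F)
    (hKS : ∀ g ∈ glFiniteIntegralLevel n F,
      (∀ v ∈ S, ∀ i j : Fin n,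
        ((g : Matrix (Fin n) (Fin n) (FiniteAdeleRing (𝓞 F) F)) i j) v =
          (1 : Matrix (Fin n) (Fin n) (v.adicCompletion F)) i j) → g ∈ K)
    (ϖ : ∀ v : HeightOneSpectrum (𝓞 F), (v.adicCompletion F)ˣ)
    (hϖ : ∀ v, Valued.v ((ϖ v : (v.adicCompletion F)ˣ) : v.adicCompletion F) =
      WithZero.exp (-1 : ℤ))
    (k : Type) [Field k] [CharP k p] [IsAlgClosed k] [TopologicalSpace k] [DiscreteTopology k]
    (hk : ∀ x : k, ∃ m : ℕ, 0 < m ∧ x ^ p ^ m = x)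
    {i : ℕ} {a : HeightOneSpectrum (𝓞 F) → ℕ → k}
    (hocc : HeckeEigenvaluesOccurGL n F k S K ϖ i a) :
    ∃ ρ : GaloisRepresentations.FramedGaloisRep F k n,
      ρ.toGaloisRep.IsSemisimple ∧
      (∀ v : HeightOneSpectrum (𝓞 F), v ∉ S → ρ.IsUnramifiedAt v) ∧
      ∀ v : HeightOneSpectrum (𝓞 F), v ∉ S →
        ρ.HasFrobCharpolyAt v (scholzeArithFrobPolynomial n v.residueCard (a v)) ∧
          ∀ 𝔓 ∈ v.primesAbove, ∀ σ : absoluteGaloisGroup F, IsArithFrobAt (𝓞 F) σ 𝔓 →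
            ((ρ σ : GL (Fin n) k) : Matrix (Fin n) (Fin n) k).det =
              ((v.residueCard : k) ^ (n * (n + 1) / 2) * a v n)⁻¹ := by
  obtain ⟨ρ, hss, hur, hfrob⟩ := h F hF n hn p S hSp hSc hSr K hKo hKi hKS ϖ hϖ k hk i a hocc
  exact ⟨ρ, hss, hur, fun v hv =>
    hasFrobCharpolyAt_of_charpolyRev_eq_scholzeHeckePolynomial hn ρ v _ _ (hfrob v hv)⟩

/-! ### Dictionary with the Chenevier-determinant vocabulary (`HeckeDeterminant`) -/

section Dictionary

variable {k : Type*} [CommRing k]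

/-- **The two encodings of Scholze's `P_v` agree.**  The `Automorphic` polynomial
`scholzeHeckePolynomial n q a = ∑_{j=0}^{n} (−1)^j q^{j(j+1)/2} a_j X^j` (indexed by the residue
cardinality `q` and the double-coset eigenvalues `a j = ψ(T^{(j)}_v)`) is the
`GaloisRepresentations` polynomial `1 − c_1 X + c_2 X² − … + (−1)ⁿ c_n Xⁿ` of
`Literature.NumberTheory.GaloisRepresentations.HeckeDeterminant` at the integral coefficients
`c_j = q^{j(n+1)/2} T_{j,v} ↦ q^{j(j+1)/2} a_j` ([Scholze2015, §V.4, display before Thm. V.4.1];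
`q^{j(n+1)/2} T_{j,v} = q^{j(j+1)/2} T^{(j)}_v` under the unitary Satake normalisation).
[cite: Scholze2015, §V.4 (definition of P_v)] -/
theorem scholzeHeckePolynomial_eq_galoisRepresentations (n q : ℕ) (a : ℕ → k) :
    scholzeHeckePolynomial n q a =
      GaloisRepresentations.scholzeHeckePolynomial n
        (fun j => (q : k) ^ (j * (j + 1) / 2) * a j) := by
  ext j
  rcases Nat.eq_zero_or_pos j with rfl | hj
  · simp
  by_cases hjn : j ≤ n
  · rw [scholzeHeckePolynomial_coeff q a hj hjn,
      GaloisRepresentations.coeff_scholzeHeckePolynomial n _ hj hjn, mul_assoc]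
  · rw [not_le] at hjn
    rw [coeff_eq_zero_of_natDegree_lt ((natDegree_scholzeHeckePolynomial_le n q a).trans_lt hjn)]
    simp only [GaloisRepresentations.scholzeHeckePolynomial, coeff_add, coeff_one,
      finsetSum_coeff, coeff_C_mul, coeff_X_pow]
    rw [if_neg (by omega), Finset.sum_eq_zero fun i hi => ?_, add_zero]
    have hi' := Finset.mem_range.mp hi
    rw [if_neg (by omega), mul_zero]

end Dictionary

/-! ### Cor. V.4.3 in the printed shape `D(1 − X·Frob_v) = P_v` -/

open Literature.NumberTheory.GaloisRepresentations in
/-- **Scholze 2015, Cor. V.4.3 (trivial weight) as a statement about the determinant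
`D = det ∘ σ_ψ`.**  Under the hypotheses of the named fact
`Scholze2015_galoisRep_of_modPEigensystem`, the representation `ρ = σ_ψ` it provides is
semisimple and unramified outside `S`, and its Chenevier determinant `det ∘ ρ`
(`GroupDeterminant.ofFramedRep ρ`, [Scholze2015, Rem. V.1.9]) is continuous
([Scholze2015, Def. V.1.8]), unramified outside `S` (its characteristic polynomials are invariant
under every inertia group above `v ∉ S`, `GaloisDeterminant.IsUnramifiedAt`) and satisfies
`D(1 − X·Frob_v) = P_v(ψ) = ∑_j (−1)^j q_v^{j(j+1)/2} ψ(T^{(j)}_v) X^j` for every **geometric**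
Frobenius `Frob_v` at every prime above every `v ∉ S`
(`GaloisDeterminant.HasGeomFrobRevCharpolyAt`) — literally the printed conclusion of
[Scholze2015, Cor. V.4.3] / the `m = 1`, `ξ = 1` case of [Scholze2015, Thm. V.4.1] specialised
along `ψ`.  Obtained from the fact (hypothesis `h`, D-0014) by `IsGeomFrobAt σ ↔ IsArithFrobAt σ⁻¹`
and the `det ∘ ρ` lemmas of `HeckeDeterminant`.
[cite: Scholze2015, Cor. V.4.3 and Thm. V.4.1 (§V.4, pp. 66–67), Def. V.1.8, Rem. V.1.9] -/
theorem Scholze2015_galoisRep_of_modPEigensystem.exists_determinant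
    (h : Scholze2015_galoisRep_of_modPEigensystem)
    (F : Type) [Field F] [NumberField F] (hF : IsTotallyReal F ∨ IsCMField F)
    {n : ℕ} (hn : 1 ≤ n) (p : ℕ) [Fact p.Prime] (S : Finset (HeightOneSpectrum (𝓞 F)))
    (hSp : ∀ v : HeightOneSpectrum (𝓞 F), ((p : ℕ) : 𝓞 F) ∈ v.asIdeal → v ∈ S)
    (hSc : ∀ τ : F ≃ₐ[maximalRealSubfield F] F, ∀ v ∈ S, τ • v ∈ S)
    (hSr : ∀ v : HeightOneSpectrum (𝓞 F), v ∉ S →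
      v.asIdeal.ramificationIdx (𝓞 (maximalRealSubfield F)) = 1)
    (K : Subgroup (GL (Fin n) (FiniteAdeleRing (𝓞 F) F)))
    (hKo : IsOpen (K : Set (GL (Fin n) (FiniteAdeleRing (𝓞 F) F))))
    (hKi : K ≤ glFiniteIntegralLevel n F)
    (hKS : ∀ g ∈ glFiniteIntegralLevel n F,
      (∀ v ∈ S, ∀ i j : Fin n,
        ((g : Matrix (Fin n) (Fin n) (FiniteAdeleRing (𝓞 F) F)) i j) v =
          (1 : Matrix (Fin n) (Fin n) (v.adicCompletion F)) i j) → g ∈ K)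
    (ϖ : ∀ v : HeightOneSpectrum (𝓞 F), (v.adicCompletion F)ˣ)
    (hϖ : ∀ v, Valued.v ((ϖ v : (v.adicCompletion F)ˣ) : v.adicCompletion F) =
      WithZero.exp (-1 : ℤ))
    (k : Type) [Field k] [CharP k p] [IsAlgClosed k] [TopologicalSpace k] [DiscreteTopology k]
    (hk : ∀ x : k, ∃ m : ℕ, 0 < m ∧ x ^ p ^ m = x)
    {i : ℕ} {a : HeightOneSpectrum (𝓞 F) → ℕ → k}
    (hocc : HeckeEigenvaluesOccurGL n F k S K ϖ i a) :
    ∃ ρ : FramedGaloisRep F k n,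
      ρ.toGaloisRep.IsSemisimple ∧
      (∀ v : HeightOneSpectrum (𝓞 F), v ∉ S → ρ.IsUnramifiedAt v) ∧
      (GroupDeterminant.ofFramedRep ρ).IsContinuous ∧
      (∀ v : HeightOneSpectrum (𝓞 F), v ∉ S →
        GaloisDeterminant.IsUnramifiedAt v (GroupDeterminant.ofFramedRep ρ)) ∧
      ∀ v : HeightOneSpectrum (𝓞 F), v ∉ S →
        GaloisDeterminant.HasGeomFrobRevCharpolyAt v
          (scholzeHeckePolynomial n v.residueCard (a v)) (GroupDeterminant.ofFramedRep ρ) := by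
  obtain ⟨ρ, hss, hur, hfrob⟩ := h F hF n hn p S hSp hSc hSr K hKo hKi hKS ϖ hϖ k hk i a hocc
  refine ⟨ρ, hss, hur, GroupDeterminant.isContinuous_ofFramedRep ρ,
    fun v hv => GaloisDeterminant.isUnramifiedAt_ofFramedRep (hur v hv), fun v hv => ?_⟩
  rw [GaloisDeterminant.hasGeomFrobRevCharpolyAt_ofFramedRep_iff]
  intro 𝔓 h𝔓 σ hσ
  simpa only [inv_inv] using hfrob v hv 𝔓 h𝔓 σ⁻¹ (isGeomFrobAt_iff.mp hσ)

open Literature.NumberTheory.GaloisRepresentations in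
/-- **The mod-`p` eigensystem `ψ` carries a Hecke determinant** (route notion
`HasHeckeDeterminant` of `Literature.NumberTheory.GaloisRepresentations.HeckeDeterminant`, with
`T := k`, the zero ideal, and the specialised Hecke polynomials `ψ(P_v)`): under the hypotheses of
`Scholze2015_galoisRep_of_modPEigensystem` there is, for every `N ≥ 1`, an `n`-dimensional
continuous Galois determinant of `F` with values in `k` (modulo an ideal `I` with `I ^ N = 0`),
unramified outside `S`, with `D(1 − X·Frob_v) = ∑_j (−1)^j q_v^{j(j+1)/2} ψ(T^{(j)}_v) X^j` for all
`v ∉ S` — the conclusion of [Scholze2015, Thm. V.4.1] for `m = 1`, `ξ = 1` composed with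
`ψ : 𝕋_{F,S}(K, i, 1) → k` (as in the proof of Cor. V.4.3, p. 67), realised by `det ∘ σ_ψ`
(`HasHeckeDeterminant.of_framedGaloisRep`).  Hypothesis `h` is the named fact (D-0014).
[cite: Scholze2015, Thm. V.4.1 and Cor. V.4.3 (§V.4, pp. 66–67)] -/
theorem Scholze2015_galoisRep_of_modPEigensystem.hasHeckeDeterminant
    (h : Scholze2015_galoisRep_of_modPEigensystem)
    (F : Type) [Field F] [NumberField F] (hF : IsTotallyReal F ∨ IsCMField F)
    {n : ℕ} (hn : 1 ≤ n) (p : ℕ) [Fact p.Prime] (S : Finset (HeightOneSpectrum (𝓞 F)))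
    (hSp : ∀ v : HeightOneSpectrum (𝓞 F), ((p : ℕ) : 𝓞 F) ∈ v.asIdeal → v ∈ S)
    (hSc : ∀ τ : F ≃ₐ[maximalRealSubfield F] F, ∀ v ∈ S, τ • v ∈ S)
    (hSr : ∀ v : HeightOneSpectrum (𝓞 F), v ∉ S →
      v.asIdeal.ramificationIdx (𝓞 (maximalRealSubfield F)) = 1)
    (K : Subgroup (GL (Fin n) (FiniteAdeleRing (𝓞 F) F)))
    (hKo : IsOpen (K : Set (GL (Fin n) (FiniteAdeleRing (𝓞 F) F))))
    (hKi : K ≤ glFiniteIntegralLevel n F)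
    (hKS : ∀ g ∈ glFiniteIntegralLevel n F,
      (∀ v ∈ S, ∀ i j : Fin n,
        ((g : Matrix (Fin n) (Fin n) (FiniteAdeleRing (𝓞 F) F)) i j) v =
          (1 : Matrix (Fin n) (Fin n) (v.adicCompletion F)) i j) → g ∈ K)
    (ϖ : ∀ v : HeightOneSpectrum (𝓞 F), (v.adicCompletion F)ˣ)
    (hϖ : ∀ v, Valued.v ((ϖ v : (v.adicCompletion F)ˣ) : v.adicCompletion F) =
      WithZero.exp (-1 : ℤ))
    (k : Type) [Field k] [CharP k p] [IsAlgClosed k] [TopologicalSpace k] [DiscreteTopology k]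
    (hk : ∀ x : k, ∃ m : ℕ, 0 < m ∧ x ^ p ^ m = x)
    {i : ℕ} {a : HeightOneSpectrum (𝓞 F) → ℕ → k}
    (hocc : HeckeEigenvaluesOccurGL n F k S K ϖ i a) {N : ℕ} (hN : 1 ≤ N) :
    HasHeckeDeterminant F n N (↑S : Set (HeightOneSpectrum (𝓞 F))) k
      fun v => scholzeHeckePolynomial n v.residueCard (a v) := by
  obtain ⟨ρ, -, hur, hfrob⟩ := h F hF n hn p S hSp hSc hSr K hKo hKi hKS ϖ hϖ k hk i a hocc
  refine HasHeckeDeterminant.of_framedGaloisRep ρ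
    (fun v hv => hur v fun hvS => hv (Finset.mem_coe.2 hvS))
    (fun v hv 𝔓 h𝔓 σ hσ => ?_) hN
  simpa only [inv_inv] using
    hfrob v (fun hvS => hv (Finset.mem_coe.2 hvS)) 𝔓 h𝔓 σ⁻¹ (isGeomFrobAt_iff.mp hσ)

end Literature.NumberTheory.Automorphic

/-!
## The printed proof of Cor. V.4.3, formalised modulo its two inputs

[Scholze2015, Cor. V.4.3, proof, p. 67]: "This is immediate from Theorem V.4.1 and [ChenevierDet]."
The sections below prove every step of that sentence which does not lie inside the two cited
black boxes, and then the reduction itself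
(`Scholze2015_galoisRep_of_modPEigensystem.of_heckeDeterminant_of_chenevier`):

1. *Base change of determinants* (`GroupDeterminant.baseChange` along a ring homomorphism, with
   `revCharpoly_baseChange_of`, continuity, unramifiedness and Frobenius identities preserved) and
   the *specialisation of a Hecke determinant along a character* killing the nilpotent ideal
   (`HasHeckeDeterminant.exists_galoisDeterminant_of_ringHom`): "compose `D` with `ψ`".
2. *The kernel of a semisimple representation is cut out by its characteristic polynomials*
   (`apply_eq_one_of_mem_charpolyKer`, by Clifford's theorem and the Brauer–Nesbitt theorem of
   `Literature/RepresentationTheory/Semisimple`), whence the semisimple `ρ` with `det ∘ ρ = D`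
   furnished by Chenevier's Theorem A is *continuous* when `D` is (compact group, discrete field:
   [Chenevier2014Determinants, §2.5]) and *unramified* wherever `D` is
   (`GaloisDeterminant.exists_framedGaloisRep`).
3. *The eigen-character* `θ_ψ : 𝕋 → k` of the Hecke algebra attached to an occurring eigensystem
   (`exists_algHom_of_common_eigenvector`).

The two inputs enter the reduction theorem as hypotheses stated in the tree's vocabulary:
Thm. V.4.1 (`m = 1`, `ξ = 1`, `k`-coefficients) as a `HasHeckeDeterminant` over the image of the
spherical Hecke algebra in `End_k H^i(X_K, k)`, and Chenevier's Theorem A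
([Chenevier2014Determinants, Thm. A, §2.2]) as the existence of a semisimple `ρ : Γ → GL_d(k)` with
`det(1 - X ρ(g)) = D(1 - X g)` over an algebraically closed field.  Neither is available in the
tree; they are NOT vendored here as named facts (D-0026).
-/

open scoped TensorProduct

namespace Literature.NumberTheory.GaloisRepresentations

universe u w

namespace GroupDeterminant

section BaseChangeAux

variable (A B : Type u) [CommRing A] [CommRing B] (G : Type w) [Monoid G]
variable (S : Type u) [CommRing S] [Algebra A S] [Algebra B S]

/-- Auxiliary for `GroupDeterminant.baseChange`: the `B`-algebra map `B[G] → S ⊗[A] A[G]`,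
`b·h ↦ b ⊗ h` (`S` a commutative ring which is both an `A`- and a `B`-algebra). [folklore] -/
def baseChangeInr : MonoidAlgebra B G →ₐ[B] S ⊗[A] MonoidAlgebra A G :=
  MonoidAlgebra.lift B (S ⊗[A] MonoidAlgebra A G) G
    ((Algebra.TensorProduct.includeRight (R := A) (A := S)
        (B := MonoidAlgebra A G)).toMonoidHom.comp (MonoidAlgebra.of A G))

/-- `baseChangeInr` on a monomial: `b·h ↦ b ⊗ h`. [folklore] -/
lemma baseChangeInr_single (h : G) (b : B) :
    baseChangeInr A B G S (MonoidAlgebra.single h b) =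
      algebraMap B S b ⊗ₜ[A] MonoidAlgebra.single h (1 : A) := by
  rw [baseChangeInr, MonoidAlgebra.lift_single, Algebra.smul_def,
    Algebra.TensorProduct.algebraMap_apply]
  change (algebraMap B S b ⊗ₜ[A] (1 : MonoidAlgebra A G)) *
      ((1 : S) ⊗ₜ[A] MonoidAlgebra.single h (1 : A)) = _
  rw [Algebra.TensorProduct.tmul_mul_tmul, one_mul, mul_one]

/-- Elements `s ⊗ 1` of the left factor are central in `S ⊗[A] A[G]`. [folklore] -/
lemma commute_tmul_one (s : S) (x : S ⊗[A] MonoidAlgebra A G) :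
    Commute (s ⊗ₜ[A] (1 : MonoidAlgebra A G)) x := by
  induction x using TensorProduct.induction_on with
  | zero => exact Commute.zero_right _
  | tmul s' y =>
    change (s ⊗ₜ[A] (1 : MonoidAlgebra A G)) * (s' ⊗ₜ[A] y) = (s' ⊗ₜ[A] y) * (s ⊗ₜ[A] 1)
    rw [Algebra.TensorProduct.tmul_mul_tmul, Algebra.TensorProduct.tmul_mul_tmul, one_mul,
      mul_one, mul_comm]
  | add x y hx hy => exact Commute.add_right hx hy

/-- Auxiliary for `GroupDeterminant.baseChange`: the canonical `S`-algebra map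
`S ⊗[B] B[G] → S ⊗[A] A[G]` (both are `S[G]`), `s ⊗ b·h ↦ (b s) ⊗ h`. [folklore] -/
def baseChangeAux : S ⊗[B] MonoidAlgebra B G →ₐ[S] S ⊗[A] MonoidAlgebra A G :=
  Algebra.TensorProduct.lift (Algebra.TensorProduct.includeLeft (S := S))
    (baseChangeInr A B G S) fun s _ => commute_tmul_one A G S s _

/-- `baseChangeAux` on `s ⊗ b·h`. [folklore] -/
lemma baseChangeAux_tmul_single (s : S) (h : G) (b : B) :
    baseChangeAux A B G S (s ⊗ₜ[B] MonoidAlgebra.single h b) =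
      (b • s) ⊗ₜ[A] MonoidAlgebra.single h (1 : A) := by
  rw [baseChangeAux, Algebra.TensorProduct.lift_tmul, Algebra.TensorProduct.includeLeft_apply,
    baseChangeInr_single, Algebra.TensorProduct.tmul_mul_tmul, one_mul, Algebra.smul_def,
    mul_comm]

/-- `baseChangeAux` on `s ⊗ h` (`h` a group element). [folklore] -/
lemma baseChangeAux_tmul_of (s : S) (h : G) :
    baseChangeAux A B G S (s ⊗ₜ[B] MonoidAlgebra.of B G h) = s ⊗ₜ[A] MonoidAlgebra.of A G h := by
  rw [MonoidAlgebra.of_apply, MonoidAlgebra.of_apply, baseChangeAux_tmul_single, one_smul]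

variable {S} in
/-- Naturality of `baseChangeAux` in `S`, along a map which is both `A`- and `B`-linear. [folklore] -/
lemma map_baseChangeAux {S' : Type u} [CommRing S'] [Algebra A S'] [Algebra B S']
    (ψ : S →ₐ[B] S') (ψA : S →ₐ[A] S') (hψ : ∀ s, ψA s = ψ s) (x : S ⊗[B] MonoidAlgebra B G) :
    Algebra.TensorProduct.map ψA (AlgHom.id A (MonoidAlgebra A G)) (baseChangeAux A B G S x) =
      baseChangeAux A B G S' (Algebra.TensorProduct.map ψ (AlgHom.id B (MonoidAlgebra B G)) x) := by
  induction x using TensorProduct.induction_on with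
  | zero => simp only [map_zero]
  | tmul s y =>
    induction y using MonoidAlgebra.induction_on generalizing s with
    | hM g =>
      rw [baseChangeAux_tmul_of, Algebra.TensorProduct.map_tmul, Algebra.TensorProduct.map_tmul,
        AlgHom.id_apply, AlgHom.id_apply, baseChangeAux_tmul_of, hψ]
    | hadd f g hf hg => simp only [TensorProduct.tmul_add, map_add, hf, hg]
    | hsmul r f hf => rw [← TensorProduct.smul_tmul, hf (r • s), TensorProduct.smul_tmul]
  | add x y hx hy => simp only [map_add, hx, hy]

end BaseChangeAux

section BaseChange

variable {A B : Type u} [CommRing A] [CommRing B] {G : Type w} [Monoid G] {d : ℕ}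

/-- **Base change of a group determinant along a ring homomorphism `φ : A → B`** (extension of
scalars of the polynomial law, Chenevier §1.1: `D ⊗_A B`): for a commutative `B`-algebra `S`,
regarded as an `A`-algebra through `A → B → S`, `(D ⊗_A B)_S := D_S` transported along
`S ⊗[B] B[G] = S ⊗[A] A[G]`. [cite: Chenevier2014Determinants, §1.1 (base change of polynomial laws)] -/
def baseChange (φ : A →+* B) (D : GroupDeterminant A G d) : GroupDeterminant B G d where
  toFun S _ _ x :=
    letI : Algebra A S := ((algebraMap B S).comp φ).toAlgebra
    D.toFun S (baseChangeAux A B G S x)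
  map_toFun {S} _ _ {S'} _ _ ψ x := by
    letI : Algebra A S := ((algebraMap B S).comp φ).toAlgebra
    letI : Algebra A S' := ((algebraMap B S').comp φ).toAlgebra
    let ψA : S →ₐ[A] S' :=
      { ψ.toRingHom with
        commutes' := fun a => by
          change ψ (algebraMap B S (φ a)) = algebraMap B S' (φ a)
          exact ψ.commutes _ }
    change ψA (D.toFun S (baseChangeAux A B G S x)) = _
    rw [D.map_toFun ψA, map_baseChangeAux A B G ψ ψA fun _ => rfl]
  toFun_one S _ _ := by
    letI : Algebra A S := ((algebraMap B S).comp φ).toAlgebra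
    change D.toFun S (baseChangeAux A B G S 1) = 1
    rw [map_one, D.toFun_one]
  toFun_mul S _ _ x y := by
    letI : Algebra A S := ((algebraMap B S).comp φ).toAlgebra
    change D.toFun S (baseChangeAux A B G S (x * y)) = _
    rw [map_mul, D.toFun_mul]
  toFun_smul S _ _ s x := by
    letI : Algebra A S := ((algebraMap B S).comp φ).toAlgebra
    change D.toFun S (baseChangeAux A B G S (s • x)) = _
    rw [map_smul, D.toFun_smul]

/-- **Characteristic polynomials commute with base change**:
`(D ⊗_A B)(1 - X g) = φ(D(1 - X g))` for every `g ∈ G`.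
[cite: Chenevier2014Determinants, §1.1–§1.3] -/
theorem revCharpoly_baseChange_of (φ : A →+* B) (D : GroupDeterminant A G d) (g : G) :
    (baseChange φ D).revCharpoly (MonoidAlgebra.of B G g) =
      (D.revCharpoly (MonoidAlgebra.of A G g)).map φ := by
  letI iAX : Algebra A B[X] := ((algebraMap B B[X]).comp φ).toAlgebra
  -- `A[X] → B[X]` as an `A`-algebra map
  let ψ : A[X] →ₐ[A] B[X] :=
    { Polynomial.mapRingHom φ with
      commutes' := fun a => by
        change Polynomial.map φ (algebraMap A A[X] a) = algebraMap B B[X] (φ a)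
        rw [Polynomial.algebraMap_apply, Polynomial.map_C, Polynomial.algebraMap_apply,
          Algebra.algebraMap_self, RingHom.id_apply]
        rfl }
  have hψ : ∀ p : A[X], ψ p = p.map φ := fun _ => rfl
  -- the right-hand side, by naturality of `D` along `ψ`
  have hnat := D.map_toFun ψ (1 - (Polynomial.X : A[X]) ⊗ₜ[A] MonoidAlgebra.of A G g)
  rw [hψ, map_sub, map_one, Algebra.TensorProduct.map_tmul, AlgHom.id_apply, hψ,
    Polynomial.map_X] at hnat
  change D.toFun B[X] (baseChangeAux A B G B[X]
      (1 - (Polynomial.X : B[X]) ⊗ₜ[B] MonoidAlgebra.of B G g)) =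
    (D.toFun A[X] (1 - (Polynomial.X : A[X]) ⊗ₜ[A] MonoidAlgebra.of A G g)).map φ
  rw [hnat, map_sub, map_one, baseChangeAux_tmul_of]

variable [TopologicalSpace G] [TopologicalSpace A] [TopologicalSpace B]

/-- Base change along a continuous ring homomorphism preserves continuity of determinants.
[cite: Scholze2015, Def. V.1.8] -/
theorem _root_.Literature.NumberTheory.GaloisRepresentations.ChenevierDeterminant.IsContinuous.baseChange
    {D : GroupDeterminant A G d} (hD : D.IsContinuous) {φ : A →+* B} (hφ : Continuous φ) :
    (GroupDeterminant.baseChange φ D).IsContinuous := by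
  intro i
  have : (fun g : G =>
      ((GroupDeterminant.baseChange φ D).revCharpoly (MonoidAlgebra.of B G g)).coeff i) =
      fun g => φ ((D.revCharpoly (MonoidAlgebra.of A G g)).coeff i) := by
    funext g
    rw [revCharpoly_baseChange_of, Polynomial.coeff_map]
  rw [this]
  exact hφ.comp (hD i)

end BaseChange

end GroupDeterminant

/-! ### Base change of Galois determinants -/

namespace GaloisDeterminant

variable {F : Type u} [Field F] {A B : Type u} [CommRing A] [CommRing B] {d : ℕ}

/-- Base change preserves the Frobenius identity `D(1 - X Frob_v) = P_v` (with `P_v ↦ φ(P_v)`).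
[folklore] -/
theorem HasGeomFrobRevCharpolyAt.baseChange {v : HeightOneSpectrum (𝓞 F)} {P : A[X]}
    {D : GaloisDeterminant F A d} (h : D.HasGeomFrobRevCharpolyAt v P) (φ : A →+* B) :
    HasGeomFrobRevCharpolyAt v (P.map φ) (GroupDeterminant.baseChange φ D) := by
  intro 𝔓 h𝔓 σ hσ
  rw [GroupDeterminant.revCharpoly_baseChange_of, h 𝔓 h𝔓 σ hσ]

/-- Base change preserves unramifiedness (in the characteristic-polynomial sense). [folklore] -/
theorem IsUnramifiedAt.baseChange {v : HeightOneSpectrum (𝓞 F)} {D : GaloisDeterminant F A d}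
    (h : D.IsUnramifiedAt v) (φ : A →+* B) :
    IsUnramifiedAt v (GroupDeterminant.baseChange φ D) := by
  intro 𝔓 h𝔓 σ hσ g
  rw [GroupDeterminant.revCharpoly_baseChange_of, GroupDeterminant.revCharpoly_baseChange_of,
    h 𝔓 h𝔓 σ hσ g]

end GaloisDeterminant

/-! ### Specialising a Hecke determinant along a character of the Hecke algebra -/

section Specialise

variable {F : Type u} [Field F] {n N : ℕ} {S : Set (HeightOneSpectrum (𝓞 F))}
  {T : Type u} [CommRing T] [TopologicalSpace T] [IsTopologicalRing T]
  {P : HeightOneSpectrum (𝓞 F) → T[X]}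
  {k : Type u} [CommRing k] [TopologicalSpace k]

/-- **Specialisation of a Hecke determinant along a character** ([Scholze2015, proof of
Cor. V.4.3, p. 67]: `ψ` kills the nilpotent ideal `I`, so composing the `𝕋/I`-valued
determinant of Thm. V.4.1 with `ψ` gives an `𝔽̄_p`-valued one).  Let `H` be a Hecke determinant
modulo `I` (`I ^ N = 0`) with values in `T`, unramified outside `S` and with
`D(1 - X Frob_v) = P_v mod I`, and let `θ : T → k` be a continuous ring homomorphism killing `I`.
Then `θ ∘ D` is a continuous `k`-valued `n`-dimensional Galois determinant, unramified outside `S`,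
with `(θ ∘ D)(1 - X Frob_v) = θ(P_v)` for all `v ∉ S`. [cite: Scholze2015, Cor. V.4.3 (proof)] -/
theorem HeckeDeterminantCompletedCohomology.exists_galoisDeterminant_of_ringHom
    (H : HeckeDeterminantCompletedCohomology F n N S T P) (θ : T →+* k) (hθ : Continuous θ)
    (hθI : ∀ x ∈ H.ideal, θ x = 0) :
    ∃ D : GaloisDeterminant F k n, D.IsContinuous ∧ (∀ v ∉ S, D.IsUnramifiedAt v) ∧
      ∀ v ∉ S, D.HasGeomFrobRevCharpolyAt v ((P v).map θ) := by
  -- `θ` factors through `T ⧸ I`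
  let θ' : T ⧸ H.ideal →+* k := Ideal.Quotient.lift H.ideal θ hθI
  have hθ' : Continuous θ' := by
    rw [(QuotientRing.isOpenQuotientMap_mk H.ideal).isQuotientMap.continuous_iff]
    exact hθ
  refine ⟨GroupDeterminant.baseChange θ' H.det, H.isContinuous.baseChange hθ',
    fun v hv => (H.isUnramifiedAt v hv).baseChange θ', fun v hv => ?_⟩
  have h := (H.hasGeomFrobRevCharpolyAt v hv).baseChange θ'
  rwa [Polynomial.map_map] at h

/-- Over a **reduced** `k` every ring homomorphism `θ : T → k` kills the nilpotent ideal of a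
Hecke determinant, so `θ ∘ D` is defined: the case `k = 𝔽̄_p` of [Scholze2015, Cor. V.4.3].
[cite: Scholze2015, Cor. V.4.3 (proof)] -/
theorem HasHeckeDeterminant.exists_galoisDeterminant_of_ringHom [IsReduced k]
    (hH : HasHeckeDeterminant F n N S T P) (θ : T →+* k) (hθ : Continuous θ) :
    ∃ D : GaloisDeterminant F k n, D.IsContinuous ∧ (∀ v ∉ S, D.IsUnramifiedAt v) ∧
      ∀ v ∉ S, D.HasGeomFrobRevCharpolyAt v ((P v).map θ) := by
  obtain ⟨H⟩ := hH
  refine H.exists_galoisDeterminant_of_ringHom θ hθ fun x hx => ?_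
  have hxN : x ^ N = 0 := by
    have : x ^ N ∈ H.ideal ^ N := Ideal.pow_mem_pow hx N
    rwa [H.ideal_pow_eq_bot, Ideal.mem_bot] at this
  have hnil : IsNilpotent (θ x) := ⟨N, by rw [← map_pow, hxN, map_zero]⟩
  exact hnil.eq_zero

end Specialise

end Literature.NumberTheory.GaloisRepresentations

namespace Literature.NumberTheory.Automorphic

/-! ### The kernel of a semisimple representation is cut out by characteristic polynomials -/

section CharpolyKernel

variable {k : Type*} [Field k] {Γ : Type*} [Group Γ] {V : Type*} [AddCommGroup V] [Module k V]
  [FiniteDimensional k V]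

/-- For a representation `ρ` of a group `Γ` on a finite-dimensional vector space, the set of
`σ ∈ Γ` with `det(X - ρ(gσ)) = det(X - ρ(g))` for **all** `g ∈ Γ` is a subgroup of `Γ`
(it contains `ker ρ`, and equals it when `ρ` is semisimple: `apply_eq_one_of_mem_charpolyKer`).
[folklore] -/
def charpolyKer (ρ : Representation k Γ V) : Subgroup Γ where
  carrier := {σ | ∀ g : Γ, (ρ (g * σ)).charpoly = (ρ g).charpoly}
  one_mem' g := by rw [mul_one]
  mul_mem' {σ τ} hσ hτ g := by rw [← mul_assoc, hτ, hσ]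
  inv_mem' {σ} hσ g := by
    have h := hσ (g * σ⁻¹)
    rw [inv_mul_cancel_right] at h
    exact h.symm

/-- Membership in `charpolyKer`. [folklore] -/
theorem mem_charpolyKer_iff {ρ : Representation k Γ V} {σ : Γ} :
    σ ∈ charpolyKer ρ ↔ ∀ g : Γ, (ρ (g * σ)).charpoly = (ρ g).charpoly :=
  Iff.rfl

/-- Characteristic polynomials of a representation are class functions (the tree's
`LinearMap.charpoly_mul_comm` of `GaloisRepFrobeniusProofs`). [folklore] -/
theorem charpoly_apply_conj (ρ : Representation k Γ V) (g h : Γ) :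
    (ρ (h * g * h⁻¹)).charpoly = (ρ g).charpoly := by
  rw [map_mul, LinearMap.charpoly_mul_comm, ← map_mul, inv_mul_cancel_left]

/-- `charpolyKer ρ` is a normal subgroup. [folklore] -/
theorem charpolyKer_normal (ρ : Representation k Γ V) : (charpolyKer ρ).Normal := by
  refine ⟨fun σ hσ h g => ?_⟩
  -- `det(X - ρ(g h σ h⁻¹)) = det(X - ρ(h⁻¹ g h σ)) = det(X - ρ(h⁻¹ g h)) = det(X - ρ(g))`
  have e1 : g * (h * σ * h⁻¹) = h * (h⁻¹ * g * h * σ) * h⁻¹ := by group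
  rw [e1, charpoly_apply_conj, hσ (h⁻¹ * g * h)]
  have e2 : h⁻¹ * g * h = h⁻¹ * g * h⁻¹⁻¹ := by rw [inv_inv]
  rw [e2, charpoly_apply_conj]

/-- Elements of `charpolyKer ρ` have the characteristic polynomial of the identity. [folklore] -/
theorem charpoly_eq_of_mem_charpolyKer {ρ : Representation k Γ V} {σ : Γ} (hσ : σ ∈ charpolyKer ρ) :
    (ρ σ).charpoly = (LinearMap.id : V →ₗ[k] V).charpoly := by
  have h := hσ 1
  rwa [one_mul, map_one] at h

omit [FiniteDimensional k V] in
/-- The trivial representation is semisimple (every subspace is a subrepresentation and has a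
complement). [folklore] -/
theorem isSemisimpleRepresentation_trivial (G : Type*) [Monoid G] :
    (Representation.trivial k G V).IsSemisimpleRepresentation := by
  refine ⟨fun a => ?_⟩
  obtain ⟨q, hq⟩ := a.toSubmodule.exists_isCompl
  refine ⟨⟨q, fun g v hv => hv⟩, ?_⟩
  rw [isCompl_iff, disjoint_iff, codisjoint_iff] at hq ⊢
  refine ⟨Subrepresentation.toSubmodule_injective ?_, Subrepresentation.toSubmodule_injective ?_⟩
  · rw [Subrepresentation.toSubmodule_inf]; exact hq.1
  · rw [Subrepresentation.toSubmodule_sup]; exact hq.2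

open Literature.RepresentationTheory in
/-- **The kernel of a semisimple representation is cut out by its characteristic polynomials.**
Let `ρ` be a semisimple representation of a group `Γ` on a finite-dimensional vector space over a
field `k` (any characteristic) and let `σ ∈ Γ` satisfy `det(X - ρ(gσ)) = det(X - ρ(g))` for all
`g ∈ Γ`.  Then `ρ(σ) = 1`.  Proof: such `σ` form a normal subgroup `N` (`charpolyKer`) on which
every characteristic polynomial is `(X - 1)^n`; `ρ|_N` is semisimple by Clifford's theorem
(`Literature.RepresentationTheory.Semisimple.Representation.isSemisimpleRepresentation_restrictSubgroup`),
hence equivalent to the trivial representation by the Brauer–Nesbitt theorem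
(`Literature.RepresentationTheory.Semisimple.Representation.nonempty_equiv_of_charpoly_eq`).
(This is the representation-theoretic content of Chenevier's `ker ρ = ker (det ∘ ρ)`,
[Chenevier2014Determinants, Thm. A / §2.2, first theorem].) [folklore] -/
theorem apply_eq_one_of_mem_charpolyKer {ρ : Representation k Γ V}
    (hρ : ρ.IsSemisimpleRepresentation) {σ : Γ} (hσ : σ ∈ charpolyKer ρ) : ρ σ = LinearMap.id := by
  haveI : (charpolyKer ρ).Normal := charpolyKer_normal ρ
  haveI h1 := Semisimple.Representation.isSemisimpleRepresentation_restrictSubgroup ρ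
    (charpolyKer ρ) hρ
  haveI h2 := isSemisimpleRepresentation_trivial (k := k) (V := V) (charpolyKer ρ)
  have hcp : ∀ m : charpolyKer ρ,
      (Semisimple.Representation.restrictSubgroup ρ (charpolyKer ρ) m).charpoly =
        (_root_.Representation.trivial k (charpolyKer ρ) V m).charpoly := fun m => by
    rw [Semisimple.Representation.restrictSubgroup_apply]
    exact charpoly_eq_of_mem_charpolyKer m.2
  obtain ⟨e⟩ := Semisimple.Representation.nonempty_equiv_of_charpoly_eq _ _ hcp
  have h := Representation.Equiv.conj_apply_self (⟨σ, hσ⟩ : charpolyKer ρ) e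
  -- `e ∘ ρ(σ) ∘ e⁻¹ = 1`, hence `ρ(σ) = 1`
  have h' : e.toLinearEquiv.conj (ρ σ) = e.toLinearEquiv.conj LinearMap.id := by
    rw [LinearEquiv.conj_id]; exact h
  exact e.toLinearEquiv.conj.injective h'

end CharpolyKernel

/-! ### Openness of `charpolyKer` for compact groups and discrete coefficients -/

section Topology

variable {k : Type*} [Field k] [TopologicalSpace k] [DiscreteTopology k]
  {Γ : Type*} [Group Γ] [TopologicalSpace Γ] [ContinuousMul Γ] [CompactSpace Γ]
  {V : Type*} [AddCommGroup V] [Module k V] [FiniteDimensional k V]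

/-- If `Γ` is a compact topological group, `k` is discrete and the coefficients of
`g ↦ det(X - ρ(g))` are continuous (i.e. locally constant), then `charpolyKer ρ` is an **open**
subgroup (tube lemma: the locally constant map `g ↦ det(X - ρ(g))` is right-uniformly locally
constant). [folklore] -/
theorem isOpen_charpolyKer (ρ : Representation k Γ V)
    (hc : ∀ i : ℕ, Continuous fun g : Γ => (ρ g).charpoly.coeff i) :
    IsOpen (charpolyKer ρ : Set Γ) := by
  -- finitely many coefficients determine the characteristic polynomial
  set d := Module.finrank k V with hd
  let c : Γ → (Fin (d + 1) → k) := fun g i => (ρ g).charpoly.coeff i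
  have hcc : Continuous c := continuous_pi fun i => hc i
  have hc_eq : ∀ g g' : Γ, c g = c g' ↔ (ρ g).charpoly = (ρ g').charpoly := by
    intro g g'
    constructor
    · intro h
      ext i
      by_cases hi : i ≤ d
      · exact congr_fun h ⟨i, Nat.lt_succ_of_le hi⟩
      · rw [not_le] at hi
        rw [Polynomial.coeff_eq_zero_of_natDegree_lt (by rw [LinearMap.charpoly_natDegree]; exact hi),
          Polynomial.coeff_eq_zero_of_natDegree_lt (by rw [LinearMap.charpoly_natDegree]; exact hi)]
    · intro h
      funext i
      simp only [c, h]
  -- the set where `c(gσ) = c(g)` is open in `Γ × Γ` and contains `Γ × {1}`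
  let Φ : Γ × Γ → (Fin (d + 1) → k) × (Fin (d + 1) → k) := fun p => (c (p.1 * p.2), c p.1)
  have hΦ : Continuous Φ :=
    (hcc.comp (continuous_fst.mul continuous_snd)).prodMk (hcc.comp continuous_fst)
  have hO : IsOpen (Φ ⁻¹' (Set.diagonal _)) := (isOpen_discrete _).preimage hΦ
  have hsub : (Set.univ : Set Γ) ×ˢ ({1} : Set Γ) ⊆ Φ ⁻¹' Set.diagonal _ := by
    rintro ⟨g, σ⟩ ⟨-, hσ⟩
    rw [Set.mem_singleton_iff] at hσ
    subst hσ
    simp [Φ]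
  obtain ⟨u, w, -, hw, huniv, h1w, huw⟩ :=
    generalized_tube_lemma isCompact_univ isCompact_singleton hO hsub
  -- `w ⊆ charpolyKer ρ`, so the subgroup is a neighbourhood of `1`, hence open
  refine Subgroup.isOpen_of_mem_nhds _ (Filter.mem_of_superset (hw.mem_nhds (h1w rfl)) ?_)
  intro σ hσ g
  have hmem : (g, σ) ∈ Φ ⁻¹' Set.diagonal _ := huw ⟨huniv (Set.mem_univ g), hσ⟩
  -- unfold
  have : c (g * σ) = c g := hmem
  exact (hc_eq _ _).1 this

omit [TopologicalSpace k] [DiscreteTopology k] [CompactSpace Γ] in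
/-- A homomorphism out of a topological group which kills an open subgroup is continuous (for any
topology on the target): it is constant on the cosets of that subgroup. [folklore] -/
theorem monoidHom_continuous_of_isOpen_subgroup {M : Type*} [Monoid M] [TopologicalSpace M]
    (f : Γ →* M) (U : Subgroup Γ) (hU : IsOpen (U : Set Γ)) (hle : ∀ u ∈ U, f u = 1) :
    Continuous f := by
  rw [continuous_def]
  intro s _
  rw [isOpen_iff_mem_nhds]
  intro x hx
  have hopen : IsOpen ((fun y => x⁻¹ * y) ⁻¹' (U : Set Γ)) := hU.preimage (continuous_const.mul continuous_id)
  refine Filter.mem_of_superset (hopen.mem_nhds (by simp [U.one_mem])) fun y hy => ?_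
  have hy' : f (x⁻¹ * y) = 1 := hle _ hy
  have : f y = f x := by
    rw [← mul_inv_cancel_left x y, map_mul, hy', mul_one]
  simpa [Set.mem_preimage, this] using hx

end Topology

end Literature.NumberTheory.Automorphic

/-! ### From a continuous / unramified determinant to a continuous / unramified representation -/

namespace Literature.NumberTheory.GaloisRepresentations

open Literature.NumberTheory.Automorphic

/-- `det(1 - X M) = det(1 - X N)` implies `det(X - M) = det(X - N)` for square matrices of the
same size over a non-trivial commutative ring (`Matrix.reverse_charpoly`,
`Polynomial.reflect_reflect`).  A deliberate dot-notation extension of Mathlib's `Matrix`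
namespace (like `Matrix.charpolyRev_map` of `HeckeDeterminant`). [folklore] -/
theorem _root_.Matrix.charpoly_eq_of_charpolyRev_eq {R : Type*} [CommRing R] [Nontrivial R]
    {m : Type*} [Fintype m] [DecidableEq m] {M N : Matrix m m R}
    (h : M.charpolyRev = N.charpolyRev) : M.charpoly = N.charpoly := by
  have hM := Matrix.reverse_charpoly M
  have hN := Matrix.reverse_charpoly N
  rw [Polynomial.reverse, Matrix.charpoly_natDegree_eq_dim] at hM hN
  rw [← Polynomial.reflect_reflect (N := Fintype.card m) (p := M.charpoly), hM, h, ← hN,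
    Polynomial.reflect_reflect]

section OfDeterminant

variable {k : Type*} [Field k] [TopologicalSpace k] [DiscreteTopology k]
  {Γ : Type*} [Group Γ] [TopologicalSpace Γ] [IsTopologicalGroup Γ] [CompactSpace Γ] {n : ℕ}

omit [TopologicalSpace k] [DiscreteTopology k] [TopologicalSpace Γ] [IsTopologicalGroup Γ]
  [CompactSpace Γ] in
/-- The standard representation of `GL_n` on column vectors is `Matrix.toLin'`. [folklore] -/
theorem glStdRepresentation_eq_toLin' (g : GL (Fin n) k) :
    glStdRepresentation (Fin n) k g = Matrix.toLin' (g : Matrix (Fin n) (Fin n) k) :=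
  LinearMap.ext fun v => by rw [Matrix.toLin'_apply]; rfl

omit [TopologicalSpace k] [DiscreteTopology k] [TopologicalSpace Γ] [IsTopologicalGroup Γ]
  [CompactSpace Γ] in
/-- The characteristic polynomial of `g` in the standard representation of `GL_n` composed with
`ρ₀` is the matrix characteristic polynomial `det(X - ρ₀(g))`. [folklore] -/
theorem charpoly_glStdRepresentation_comp (ρ₀ : Γ →* GL (Fin n) k) (g : Γ) :
    ((glStdRepresentation (Fin n) k).comp ρ₀ g).charpoly =
      ((ρ₀ g : GL (Fin n) k) : Matrix (Fin n) (Fin n) k).charpoly := by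
  rw [MonoidHom.comp_apply, glStdRepresentation_eq_toLin', Matrix.charpoly_toLin']

/-- **Continuity and kernel of the semisimple representation attached to a continuous
determinant** ([Chenevier2014Determinants, §2.5: Lemma "`D` continuous iff `Ker(D)` open" and
the Example following it — for a profinite group and a discrete field, the semisimple `ρ` with
`det ∘ ρ = D` is continuous iff `D` is]).  Let `Γ` be a compact topological group, `k` a
discrete field, `ρ₀ : Γ → GL_n(k)` a homomorphism whose associated representation on `kⁿ` is
semisimple, and `D` a continuous `n`-dimensional determinant of `Γ` over `k` with
`D(1 - X g) = det(1 - X ρ₀(g))` for all `g`.  Then every `σ` with `D(1 - X gσ) = D(1 - X g)` for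
all `g` lies in `ker ρ₀` (`apply_eq_one_of_mem_charpolyKer`: Clifford + Brauer–Nesbitt), this
subgroup is open (tube lemma), and so `ρ₀` is continuous.
[cite: Chenevier2014Determinants, §2.5 (continuous determinants; arXiv:0809.0415 Lemma 52, Example 53)] -/
theorem exists_continuous_of_groupDeterminant (D : GroupDeterminant k Γ n) (hD : D.IsContinuous)
    (ρ₀ : Γ →* GL (Fin n) k)
    (hss : Representation.IsSemisimpleRepresentation ((glStdRepresentation (Fin n) k).comp ρ₀))
    (hρ₀ : ∀ g : Γ, ((ρ₀ g : GL (Fin n) k) : Matrix (Fin n) (Fin n) k).charpolyRev =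
      D.revCharpoly (MonoidAlgebra.of k Γ g)) :
    Continuous ρ₀ ∧
      ∀ σ : Γ, (∀ g : Γ, D.revCharpoly (MonoidAlgebra.of k Γ (g * σ)) =
        D.revCharpoly (MonoidAlgebra.of k Γ g)) → ρ₀ σ = 1 := by
  -- the subgroup cut out by the characteristic polynomials of `D` is `charpolyKer` of `ρ₀`
  have hmem : ∀ σ : Γ, (∀ g : Γ, D.revCharpoly (MonoidAlgebra.of k Γ (g * σ)) =
      D.revCharpoly (MonoidAlgebra.of k Γ g)) → σ ∈ charpolyKer ((glStdRepresentation (Fin n) k).comp ρ₀) := by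
    intro σ hσ g
    rw [charpoly_glStdRepresentation_comp, charpoly_glStdRepresentation_comp]
    apply Matrix.charpoly_eq_of_charpolyRev_eq
    rw [hρ₀, hρ₀, hσ g]
  have hker : ∀ σ ∈ charpolyKer ((glStdRepresentation (Fin n) k).comp ρ₀), ρ₀ σ = 1 := by
    intro σ hσ
    have h := apply_eq_one_of_mem_charpolyKer hss hσ
    -- the standard representation of `GL_n` is faithful
    rw [MonoidHom.comp_apply, glStdRepresentation_eq_toLin', ← Matrix.toLin'_one] at h
    exact Units.ext (Matrix.toLin'.injective h)
  refine ⟨?_, fun σ hσ => hker σ (hmem σ hσ)⟩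
  -- continuity: `charpolyKer` is open (coefficients of `det(X - ρ₀ g)` are continuous since
  -- those of `D(1 - X g) = det(1 - X ρ₀ g)` are, the former being a reflection of the latter)
  have hc : ∀ i : ℕ, Continuous fun g : Γ =>
      ((glStdRepresentation (Fin n) k).comp ρ₀ g).charpoly.coeff i := by
    intro i
    have : (fun g : Γ => ((glStdRepresentation (Fin n) k).comp ρ₀ g).charpoly.coeff i) =
        fun g => (D.revCharpoly (MonoidAlgebra.of k Γ g)).coeff (Polynomial.revAt n i) := by
      funext g
      rw [charpoly_glStdRepresentation_comp, ← hρ₀, ← Matrix.reverse_charpoly, Polynomial.reverse,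
        Matrix.charpoly_natDegree_eq_dim, Fintype.card_fin, Polynomial.coeff_reflect,
        Polynomial.revAt_invol]
    rw [this]
    exact hD _
  exact monoidHom_continuous_of_isOpen_subgroup ρ₀ _ (isOpen_charpolyKer _ hc) hker

end OfDeterminant

/-! ### Galois determinants: Chenevier's `ρ` is a continuous framed representation, unramified
where `D` is, with the Frobenius characteristic polynomials of `D` -/

section Galois

variable {F : Type} [Field F] [NumberField F] {k : Type} [Field k] [TopologicalSpace k]
  [DiscreteTopology k] {n : ℕ}

/-- **From a continuous Galois determinant to a continuous framed Galois representation.**  Let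
`F` be a number field, `k` a discrete field, `D` a continuous `n`-dimensional Galois determinant
of `F` over `k`, and `ρ₀ : Γ_F → GL_n(k)` a homomorphism with semisimple associated
representation and `det(1 - X ρ₀(g)) = D(1 - X g)` for all `g` (as provided by Chenevier's
Theorem A over `k = \bar k`).  Then `ρ₀` is continuous — a framed Galois representation `ρ`,
semisimple — and: `ρ` is unramified at every `v` at which `D` is unramified (in the
characteristic-polynomial sense `GaloisDeterminant.IsUnramifiedAt`), and at every `v` with
`D(1 - X Frob_v) = P_v` (geometric Frobenii) one has `det(1 - X ρ(σ⁻¹)) = P_v` for all arithmetic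
Frobenii `σ` at primes above `v`.
[cite: Chenevier2014Determinants, Thm. A (§2.2) and §2.5 (arXiv:0809.0415 Lemma 52, Example 53)] -/
theorem GaloisDeterminant.exists_framedGaloisRep (D : GaloisDeterminant F k n) (hD : D.IsContinuous)
    (ρ₀ : absoluteGaloisGroup F →* GL (Fin n) k)
    (hss : Representation.IsSemisimpleRepresentation ((glStdRepresentation (Fin n) k).comp ρ₀))
    (hρ₀ : ∀ g, ((ρ₀ g : GL (Fin n) k) : Matrix (Fin n) (Fin n) k).charpolyRev =
      D.revCharpoly (MonoidAlgebra.of k _ g)) :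
    ∃ ρ : FramedGaloisRep F k n, ρ.toMonoidHom = ρ₀ ∧ ρ.toGaloisRep.IsSemisimple ∧
      (∀ v : HeightOneSpectrum (𝓞 F), D.IsUnramifiedAt v → ρ.IsUnramifiedAt v) ∧
      ∀ (v : HeightOneSpectrum (𝓞 F)) (P : k[X]), D.HasGeomFrobRevCharpolyAt v P →
        ∀ 𝔓 ∈ v.primesAbove, ∀ σ : absoluteGaloisGroup F, IsArithFrobAt (𝓞 F) σ 𝔓 →
          ((ρ σ⁻¹ : GL (Fin n) k) : Matrix (Fin n) (Fin n) k).charpolyRev = P := by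
  obtain ⟨hcont, hker⟩ := exists_continuous_of_groupDeterminant D hD ρ₀ hss hρ₀
  let ρ : FramedGaloisRep F k n := { ρ₀ with continuous_toFun := hcont }
  have hρ : ∀ g, ρ g = ρ₀ g := fun _ => rfl
  refine ⟨ρ, rfl, hss, fun v hv 𝔓 h𝔓 σ hσ => ?_, fun v P hP 𝔓 h𝔓 σ hσ => ?_⟩
  · rw [hρ]
    exact hker σ fun g => hv 𝔓 h𝔓 σ hσ g
  · rw [hρ, hρ₀]
    exact hP 𝔓 h𝔓 σ⁻¹ (isGeomFrobAt_iff.mpr (by simpa only [inv_inv] using hσ))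

end Galois

end Literature.NumberTheory.GaloisRepresentations

/-! ### The eigen-character of the Hecke algebra attached to an occurring eigensystem -/

namespace Literature.NumberTheory.Automorphic

section EigenCharacter

variable {k : Type*} [Field k] {T : Type*} [CommRing T] [Algebra k T] {H : Type*} [AddCommGroup H]
  [Module k H]

/-- **The eigen-character.**  Let a commutative `k`-algebra `T` act `k`-linearly on a vector space
`H` (`act : T → End_k H`), let `s ⊆ T` generate `T` as a `k`-algebra, and let `c ≠ 0` be a
common eigenvector of the operators `act x`, `x ∈ s`.  Then `c` is an eigenvector of every
`act x`, `x ∈ T`, and the eigenvalue is a `k`-algebra homomorphism `θ : T → k`: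
`act(x) c = θ(x) c`.  (For `T = 𝕋_{F,S}(K, i)` the image of the spherical Hecke algebra in
`End H^i(X_K, 𝔽̄_p)` and `c ∈ H^i(X_K, 𝔽̄_p)[ψ]`, `θ` is the character `ψ` of
[Scholze2015, Cor. V.4.3] through which `𝕋_{F,S}` acts on `c`.) [folklore] -/
theorem exists_algHom_of_common_eigenvector (act : T →ₐ[k] Module.End k H) {s : Set T}
    (hs : Algebra.adjoin k s = ⊤) {c : H} (hc : c ≠ 0)
    (heig : ∀ x ∈ s, ∃ μ : k, act x c = μ • c) :
    ∃ θ : T →ₐ[k] k, ∀ x : T, act x c = θ x • c := by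
  have hinj : Function.Injective fun r : k => r • c := smul_left_injective k hc
  -- every element of `T` acts on `c` by a scalar
  have hall : ∀ x : T, ∃ μ : k, act x c = μ • c := by
    intro x
    have hx : x ∈ Algebra.adjoin k s := hs ▸ Algebra.mem_top
    induction hx using Algebra.adjoin_induction with
    | mem x hx => exact heig x hx
    | algebraMap r => exact ⟨r, by rw [AlgHom.commutes, Module.algebraMap_end_apply]⟩
    | add x y _ _ hx hy =>
      obtain ⟨μ, hμ⟩ := hx
      obtain ⟨ν, hν⟩ := hy
      exact ⟨μ + ν, by rw [map_add, LinearMap.add_apply, hμ, hν, add_smul]⟩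
    | mul x y _ _ hx hy =>
      obtain ⟨μ, hμ⟩ := hx
      obtain ⟨ν, hν⟩ := hy
      exact ⟨μ * ν, by rw [map_mul, Module.End.mul_apply, hν, map_smul, hμ, smul_smul, mul_comm]⟩
  choose θ hθ using hall
  refine ⟨{ toFun := θ
            map_one' := ?_
            map_mul' := ?_
            map_zero' := ?_
            map_add' := ?_
            commutes' := ?_ }, hθ⟩
  · apply hinj
    change θ 1 • c = (1 : k) • c
    rw [← hθ 1, map_one, one_smul, Module.End.one_apply]
  · intro x y
    apply hinj
    change θ (x * y) • c = (θ x * θ y) • c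
    rw [← hθ, map_mul, Module.End.mul_apply, hθ y, map_smul, hθ x, smul_smul, mul_comm]
  · apply hinj
    change θ 0 • c = (0 : k) • c
    rw [← hθ 0, map_zero, LinearMap.zero_apply, zero_smul]
  · intro x y
    apply hinj
    change θ (x + y) • c = (θ x + θ y) • c
    rw [← hθ, map_add, LinearMap.add_apply, hθ x, hθ y, add_smul]
  · intro r
    apply hinj
    change θ (algebraMap k T r) • c = r • c
    rw [← hθ, AlgHom.commutes, Module.algebraMap_end_apply]

/-- In the situation of `exists_algHom_of_common_eigenvector`, the eigen-character takes the
prescribed eigenvalue on each generator. [folklore] -/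
theorem eigenCharacter_apply_eq {act : T →ₐ[k] Module.End k H} {c : H} (hc : c ≠ 0)
    {θ : T →ₐ[k] k} (hθ : ∀ x : T, act x c = θ x • c) {x : T} {μ : k} (hx : act x c = μ • c) :
    θ x = μ :=
  smul_left_injective k hc ((hθ x).symm.trans hx)

end EigenCharacter

/-! ### Scholze's Hecke polynomial under ring homomorphisms -/

section HeckePolynomialMap

/-- `GaloisRepresentations.scholzeHeckePolynomial` only depends on `c 1, …, c n`. [folklore] -/
theorem _root_.Literature.NumberTheory.GaloisRepresentations.scholzeHeckePolynomial_congr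
    {T : Type*} [CommRing T] (n : ℕ) {c c' : ℕ → T} (h : ∀ j, 1 ≤ j → j ≤ n → c j = c' j) :
    GaloisRepresentations.scholzeHeckePolynomial n c =
      GaloisRepresentations.scholzeHeckePolynomial n c' := by
  unfold GaloisRepresentations.scholzeHeckePolynomial
  congr 1
  refine Finset.sum_congr rfl fun i hi => ?_
  rw [h (i + 1) (by omega) (by have := Finset.mem_range.mp hi; omega)]

/-- `GaloisRepresentations.scholzeHeckePolynomial` commutes with ring homomorphisms. [folklore] -/
theorem _root_.Literature.NumberTheory.GaloisRepresentations.scholzeHeckePolynomial_map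
    {T T' : Type*} [CommRing T] [CommRing T'] (f : T →+* T') (n : ℕ) (c : ℕ → T) :
    (GaloisRepresentations.scholzeHeckePolynomial n c).map f =
      GaloisRepresentations.scholzeHeckePolynomial n (f ∘ c) := by
  unfold GaloisRepresentations.scholzeHeckePolynomial
  simp only [Polynomial.map_add, Polynomial.map_one, Polynomial.map_sum, Polynomial.map_mul,
    Polynomial.map_pow, Polynomial.map_C, Polynomial.map_X, Polynomial.map_neg, map_mul, map_pow,
    map_neg, map_one, Function.comp_apply]

end HeckePolynomialMap

/-! ### Cor. V.4.3 from Thm. V.4.1 and Chenevier's Theorem A -/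

open Literature.NumberTheory.GaloisRepresentations in
/-- **Scholze 2015, Cor. V.4.3, reduced to Thm. V.4.1 and Chenevier's Theorem A** — the printed
proof ("This is immediate from Theorem V.4.1 and [ChenevierDet]", [Scholze2015, p. 67]) with both
inputs as hypotheses and every other step proved in this file.

* `hV41` is [Scholze2015, Thm. V.4.1] for `m = 1`, trivial weight `ξ = 1` and `k`-coefficients,
  in the vocabulary of `Literature.NumberTheory.GaloisRepresentations.HeckeDeterminant`: under the
  hypotheses of the named fact on `F, n, p, S, K, ϖ, k` and for every degree `i`, there are a
  commutative (discrete) `k`-algebra `T` acting `k`-linearly on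
  `H^i(X_K, k) = ArithmeticQuotient.cohomology k ι K k i`, generated by elements `t v j`
  (`v ∉ S`, `1 ≤ j ≤ n`) acting as the Hecke operators `T_v^{(j)}` — i.e. (a presentation of)
  the image of Scholze's `𝕋_{F,S}(K, i, 1) ⊗_{𝔽_p} k` in `End_k H^i(X_K, k)`, where
  `H^i(X_K, k) = H^i(X_K, 𝔽_p) ⊗_{𝔽_p} k` Hecke-equivariantly and is finite-dimensional
  (universal coefficients; finiteness of the cohomology of arithmetic groups, Borel–Serre), so that
  the determinant of Thm. V.4.1 base-changes to it and the inverses of the `T_v^{(n)}`, being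
  polynomials in `T_v^{(n)}`, are not needed as generators — and an `N` such that `T` carries a
  Hecke determinant of dimension `n` modulo an ideal `I` with `I ^ N = 0`, unramified outside `S`
  (a determinant of `G_{F,S}` pulled back to `Γ_F`), with
  `D(1 - X Frob_v) = P_v = ∑_j (-1)^j q_v^{j(j+1)/2} t_{v,j} X^j` (`HasHeckeDeterminant`;
  `q_v^{j(n+1)/2} T_{j,v} = q_v^{j(j+1)/2} T_v^{(j)}`).
* `hChenevier` is [Chenevier2014Determinants, Thm. A (§2.2)]: over an algebraically closed field
  `k`, every `d`-dimensional determinant `D` of a group `Γ` satisfies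
  `D(1 - X g) = det(1 - X ρ(g))` (`g ∈ Γ`) for a semisimple representation `ρ : Γ → GL_d(k)`.

Proof (Scholze's, loc. cit.): the eigenclass `c` of `ψ` makes `ψ` a character `θ` of `T`
(`exists_algHom_of_common_eigenvector`); `θ` kills the nilpotent `I` (`k` is a field), so
`θ ∘ D` is a continuous `k`-valued determinant of `Γ_F`, unramified outside `S`, with
`(θ ∘ D)(1 - X Frob_v) = ψ(P_v)` (`HasHeckeDeterminant.exists_galoisDeterminant_of_ringHom`);
Chenevier's `ρ` with `det(1 - X ρ) = θ ∘ D` is continuous and unramified outside `S`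
(`GaloisDeterminant.exists_framedGaloisRep`: Clifford + Brauer–Nesbitt + tube lemma, replacing
[Chenevier2014Determinants, §2.5]) and has the required geometric-Frobenius characteristic
polynomials `ψ(P_v) = scholzeHeckePolynomial n q_v (a v)`.
[cite: Scholze2015, Cor. V.4.3 (proof, p. 67), Thm. V.4.1] [cite: Chenevier2014Determinants, Thm. A (§2.2), §2.5] -/
theorem Scholze2015_galoisRep_of_modPEigensystem.of_heckeDeterminant_of_chenevier
    (hV41 : ∀ (F : Type) [Field F] [NumberField F], IsTotallyReal F ∨ IsCMField F →
      ∀ (n : ℕ), 1 ≤ n → ∀ (p : ℕ) [Fact p.Prime] (S : Finset (HeightOneSpectrum (𝓞 F))),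
        (∀ v : HeightOneSpectrum (𝓞 F), ((p : ℕ) : 𝓞 F) ∈ v.asIdeal → v ∈ S) →
        (∀ τ : F ≃ₐ[maximalRealSubfield F] F, ∀ v ∈ S, τ • v ∈ S) →
        (∀ v : HeightOneSpectrum (𝓞 F), v ∉ S →
          v.asIdeal.ramificationIdx (𝓞 (maximalRealSubfield F)) = 1) →
      ∀ (K : Subgroup (GL (Fin n) (FiniteAdeleRing (𝓞 F) F))),
        IsOpen (K : Set (GL (Fin n) (FiniteAdeleRing (𝓞 F) F))) →
        K ≤ glFiniteIntegralLevel n F →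
        (∀ g ∈ glFiniteIntegralLevel n F,
          (∀ v ∈ S, ∀ i j : Fin n,
            ((g : Matrix (Fin n) (Fin n) (FiniteAdeleRing (𝓞 F) F)) i j) v =
              (1 : Matrix (Fin n) (Fin n) (v.adicCompletion F)) i j) → g ∈ K) →
      ∀ (ϖ : ∀ v : HeightOneSpectrum (𝓞 F), (v.adicCompletion F)ˣ),
        (∀ v, Valued.v ((ϖ v : (v.adicCompletion F)ˣ) : v.adicCompletion F) =
          WithZero.exp (-1 : ℤ)) →
      ∀ (k : Type) [Field k] [CharP k p] [IsAlgClosed k] [TopologicalSpace k] [DiscreteTopology k],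
        (∀ x : k, ∃ m : ℕ, 0 < m ∧ x ^ p ^ m = x) →
      ∀ (i : ℕ), ∃ (T : Type) (_ : CommRing T) (_ : TopologicalSpace T) (_ : DiscreteTopology T)
          (_ : Algebra k T)
          (act : T →ₐ[k] Module.End k (ArithmeticQuotient.cohomology k
            (Matrix.GeneralLinearGroup.map (algebraMap F (FiniteAdeleRing (𝓞 F) F))) K k i))
          (t : HeightOneSpectrum (𝓞 F) → ℕ → T) (N : ℕ),
        (∀ v ∉ S, ∀ j : ℕ, 1 ≤ j → j ≤ n →
          act (t v j) = ArithmeticQuotient.heckeEnd k K (GLn.sndHom n F (heckeDiagAt n F v (ϖ v) j))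
            k (Matrix.GeneralLinearGroup.map (algebraMap F (FiniteAdeleRing (𝓞 F) F))) i) ∧
        Algebra.adjoin k {x : T | ∃ v, v ∉ S ∧ ∃ j : ℕ, 1 ≤ j ∧ j ≤ n ∧ t v j = x} = ⊤ ∧
        HasHeckeDeterminant F n N (↑S : Set (HeightOneSpectrum (𝓞 F))) T fun v =>
          GaloisRepresentations.scholzeHeckePolynomial n fun j =>
            (v.residueCard : T) ^ (j * (j + 1) / 2) * t v j)
    (hChenevier : ∀ (k : Type) [Field k] [IsAlgClosed k] (Γ : Type) [Group Γ] (d : ℕ)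
      (D : GroupDeterminant k Γ d),
      ∃ ρ : Γ →* GL (Fin d) k,
        Representation.IsSemisimpleRepresentation ((glStdRepresentation (Fin d) k).comp ρ) ∧
        ∀ g : Γ, ((ρ g : GL (Fin d) k) : Matrix (Fin d) (Fin d) k).charpolyRev =
          D.revCharpoly (MonoidAlgebra.of k Γ g)) :
    Scholze2015_galoisRep_of_modPEigensystem := by
  intro F _ _ hF n hn p _ S hSp hSc hSr K hKo hKi hKS ϖ hϖ k _ _ _ _ _ hk i a hocc
  obtain ⟨T, _, _, _, _, act, t, N, hact, hgen, hH⟩ :=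
    hV41 F hF n hn p S hSp hSc hSr K hKo hKi hKS ϖ hϖ k hk i
  obtain ⟨c, hc, heig⟩ := hocc
  -- Step 1: `ψ` is a character `θ` of the Hecke algebra `T` (eigenvalues on `c`)
  obtain ⟨θ, hθ⟩ := exists_algHom_of_common_eigenvector act hgen hc (by
    rintro x ⟨v, hv, j, hj1, hjn, rfl⟩
    exact ⟨a v j, by rw [hact v hv j hj1 hjn]; exact heig v hv j hj1 hjn⟩)
  have hθt : ∀ v ∉ S, ∀ j : ℕ, 1 ≤ j → j ≤ n → θ (t v j) = a v j := fun v hv j hj1 hjn =>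
    eigenCharacter_apply_eq hc hθ (by rw [hact v hv j hj1 hjn]; exact heig v hv j hj1 hjn)
  -- Step 2: `θ ∘ D` is a continuous `k`-valued determinant, unramified outside `S`,
  -- with `(θ ∘ D)(1 - X Frob_v) = θ(P_v)` (`θ` kills the nilpotent ideal)
  obtain ⟨D, hDc, hDur, hDfrob⟩ :=
    hH.exists_galoisDeterminant_of_ringHom θ.toRingHom continuous_of_discreteTopology
  -- Step 3: Chenevier's Theorem A and continuity / unramifiedness of its `ρ`
  obtain ⟨ρ₀, hss, hρ₀⟩ := hChenevier k (absoluteGaloisGroup F) n D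
  obtain ⟨ρ, -, hρss, hρur, hρfrob⟩ := D.exists_framedGaloisRep hDc ρ₀ hss hρ₀
  have hS : ∀ v : HeightOneSpectrum (𝓞 F), v ∉ S → v ∉ (↑S : Set (HeightOneSpectrum (𝓞 F))) :=
    fun v hv hv' => hv (Finset.mem_coe.1 hv')
  refine ⟨ρ, hρss, fun v hv => hρur v (hDur v (hS v hv)), fun v hv 𝔓 h𝔓 σ hσ => ?_⟩
  rw [hρfrob v _ (hDfrob v (hS v hv)) 𝔓 h𝔓 σ hσ]
  -- Step 4: `θ(P_v) = ∑_j (-1)^j q_v^{j(j+1)/2} ψ(T_v^{(j)}) X^j`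
  rw [scholzeHeckePolynomial_eq_galoisRepresentations, AlgHom.toRingHom_eq_coe,
    GaloisRepresentations.scholzeHeckePolynomial_map]
  refine GaloisRepresentations.scholzeHeckePolynomial_congr n fun j hj1 hjn => ?_
  rw [Function.comp_apply, RingHom.coe_coe, map_mul, map_pow, map_natCast, hθt v hv j hj1 hjn]

end Literature.NumberTheory.Automorphic
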